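import Summits.BirchSwinnertonDyer.BirchSwinnertonDyer.Theorems.AdditiveBranchIMCGordTwoRankOneHeegnerKolyvaginManinKept
import Summits.BirchSwinnertonDyer.BirchSwinnertonDyer.Theorems.AdditiveBranchIMCGordTwoRankOneHeegnerKolyvaginUpper
import Summits.BirchSwinnertonDyer.BirchSwinnertonDyer.Theses.AdditiveBranchIMC
import HarnessLib

/-!
# Route `AdditiveBranchIMC` (rung K1), crux `GordTwoRankOne` (item 19358): the Heegner–Kolyvagin road,
# Part 9 — NO FREE LUNCH: the road's typed input STEP L′ is EXACTLY as strong as the crux at the pair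
# (cell `bsd-addord`, second prover lane `bsd-addord-k1-c3x`, gen 2; `--supports` only)

HONEST FRAMING. THEOREMS ONLY: no definition, no new named fact, no `sorry`; nothing is booked; the crux
stays OPEN at class level; «BSD is not proved by any of this». Lane B (gens 0, 2) runs the height-free
Heegner–Kolyvagin road (Jetchev–Skinner–Wan 2017 §7.4.1 shape AT AN ADDITIVE PRIME). Its residual of
record (Part 8, `…HeegnerKolyvaginStepL`) is the ADJUSTED index bound at a Heegner datum,
  STEP L′ : `2·ord_p[E(K):ℤP] ≤ ord_p #Ш(E/K) + ord_p ∏c_ℓ(E) + ord_p ∏c_ℓ(Wd) + 2·ord_p c(Dt)`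
(`K` a Heegner field of the conductor with `L(E^{d_K},1) ≠ 0`, `P ∈ E(K)` the Heegner point of the
parametrisation datum `Dt`, `Wd` a globally minimal model of `E^{d_K}` differing from it by a `p`-unit),
from which Part 8 derives the LOWER half `Typed.MissingLowerBoundAt W p` with PUBLISHED binders only.

THIS FILE proves the converse bookkeeping, so that the road is certified LOSS-FREE: at every such datum
(any reduction type at `p`, any odd `p` with `p ∤ #𝓞_K^×`, NO image hypothesis, NO Manin condition),
with the Gross–Zagier bookkeeping identity of Part 4 (`exists_shaAn_padicVal_eq_of_heegner_maninKept`: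
`v(q) + v(q_d) + v(∏c(E)) + 2v(t_d) + 2v(c) = 2v(I)`, `q = #Ш(E)_an`, `q_d = L(E^{d_K},1)/Ω`,
`v(#Ш(E/K)) = v(#Ш(E)) + v(#Ш(Wd))`) as the only engine:

* §17 currency: the rank-zero twist's `p`-part in Miller's currency (`Typed.MissingUpperBoundAt Wd p`,
  `Typed.MissingPPartAt Wd p`) converted to Jetchev–Skinner–Wan's `L(Wd,1)/Ω`-shape
  (`twist_le_half_of_missingUpperBoundAt`, `twist_exact_of_missingPPartAt`; the lower conversion is
  Part 6's `twist_ge_half_of_missingLowerBoundAt`).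
* §18 necessity: `adjustedIndexBound_of_missingLowerBoundAt_of_twistLower` — LOWER(E,p) ∧ LOWER(Wd,p)
  ⟹ STEP L′; `adjustedIndexUpperBound_of_missingUpperBoundAt_of_twistUpper` — UPPER(E,p) ∧ UPPER(Wd,p) ⟹
  the reverse inequality STEP U′; `adjustedIndexIdentity_of_missingPPartAt_of_twist` — both `p`-parts ⟹
  the adjusted index IDENTITY `2·ord_p[E(K):ℤP] = ord_p #Ш(E/K) + ord_p ∏c(E) + ord_p ∏c(Wd) + 2·ord_p c`
  (the `p`-part of Gross–Zagier's Conjecture V.(2.2) at an arbitrary datum); `…_of_bsdp_of_bsdp` — the same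
  from Miller's `BSDp W p ∧ BSDp Wd p`.
* §19 (Part 10, `…HeegnerKolyvaginEquivalence`): given the rank-ZERO twist's `p`-part
  (`Typed.MissingPPartAt Wd p`), STEP L′ ⟺ `Typed.MissingLowerBoundAt W p`, STEP U′ ⟺
  `Typed.MissingUpperBoundAt W p`, the adjusted index identity ⟺ `Typed.MissingPPartAt W p` ⟺ `BSDp W p`.
* §20 the `∀`-form: the crux BY NAME (`GordTwoRankOne`, as a hypothesis) together with the rank-zero lower
  half at the twists returns STEP L′ at EVERY Heegner datum of every rank-one row of the cell
  (`adjustedIndexBound_of_gordTwoRankOne_of_twistLower`) — the exact converse of Part 8's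
  `cellGordTwo_missingLowerBoundAt_rankOne_of_towerSurj_of_adjustedIndexBound` up to the twist's input.

So lane B's typed input is never STRONGER than the crux: filing STEP L′ (as a `∀`-statement over the
tower-surjective rows and their Heegner data) as a conjecture child of 19358 files a statement implied by
`BSD(E,p) ∧ BSD(E^{d_K},p)`, and on those rows 19358 ∧ 19357-at-the-twist ⟺ STEP L′ ∧ 19357-at-the-twist
modulo PUBLISHED facts. Nothing here is specific to lane A's objects (no Λ-adic branch, no `p`-adic height,
no Schneider, no A′).

References: [JetchevSkinnerWan2017] §7.4.1–§7.4.2 (pp. 29–31); [GrossZagier1986] V.§2, Conj. (V.2.2);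
[Gross1991] (2.2); [Miller2011LMS] §1, Def. 1.1; [Kato2004Asterisque] Thm. 14.5 (3).
-/

set_option autoImplicit false
set_option linter.dupNamespace false
noncomputable section

open scoped Classical NumberField
open WeierstrassCurve NumberField IsDedekindDomain
  Literature.NumberTheory.EllipticCurves Literature.NumberTheory.EllipticCurves.ModularForms
  Literature.NumberTheory.EllipticCurves.Rank1Residual
  Literature.NumberTheory.EllipticCurves.Rank1Residual.Typed
  Summit.BirchSwinnertonDyer.Rank1Residual
  Summit.BirchSwinnertonDyer.Rank1Residual.Additive
  Summit.BirchSwinnertonDyer.Rank1Residual.X11b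
  Summit.BirchSwinnertonDyer.Rank1Residual.GaloisImage
  Literature.NumberTheory.Automorphic

namespace Summit.BirchSwinnertonDyer.BirchSwinnertonDyer.Theorems.AdditiveBranchIMCGordTwoRankOne.HeegnerKolyvagin

/-! ### §17 Currency conversions for the rank-zero twist (Miller ↔ Jetchev–Skinner–Wan) -/

/-- **The rank-zero `#Ш_an` in closed form.** For `Wd/ℚ` globally minimal with `L(Wd,1) ≠ 0`:
`#Ш(Wd)_an = L(Wd,1)·#Wd(ℚ)_tors² / (Ω·∏c_ℓ)` (`Reg = 1` in rank `0`, GZK for `rank = 0`). Bookkeeping.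
[cite: Miller2011LMS, §1 and Def. 1.1] -/
theorem shaAn_eq_of_rankZero
    (hGZK : rank_eq_analyticRank_of_analyticRank_le_one) (hmod : hasEntireLFunction_rat)
    (Wd : WeierstrassCurve ℚ) [Wd.IsElliptic] [Wd.IsGloballyMinimal]
    (hL : Wd.entireLFunction 1 ≠ 0) :
    shaAn Wd = Wd.entireLFunction 1 * (Wd.torsionOrder : ℂ) ^ 2 /
      ((Wd.realPeriodRat : ℂ) * (Wd.tamagawaProduct : ℂ)) := by
  have hrd : Wd.analyticRank = 0 := (Wd.analyticRank_eq_zero_iff_holds (hmod Wd)).2 hL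
  obtain ⟨hmw, -⟩ := hGZK Wd (by rw [hrd]; exact zero_le_one)
  have hmw0 : Wd.mordellWeilRank = 0 := by rw [hmw, hrd]
  rw [shaAn_def, leadingLCoeff_eq_of_analyticRank_eq_zero Wd hrd, Wd.regulator_eq_one_of_rank_zero hmw0]
  push_cast
  rw [mul_one]

/-- **The twist's algebraic central value and its valuation in Miller's currency.** For `Wd/ℚ` globally
minimal with `L(Wd,1) ≠ 0` and `#Ш(Wd)_an = q'` rational: `L(Wd,1)/Ω = q'·∏c_ℓ/#tors²` is rational, with
`ord_p(L(Wd,1)/Ω) = ord_p q' + ord_p ∏c_ℓ(Wd) − 2·ord_p #Wd(ℚ)_tors`, and `q' ≠ 0`. Bookkeeping.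
[cite: Miller2011LMS, §1 and Def. 1.1] [cite: JetchevSkinnerWan2017, §7.4.2 (p. 31)] -/
theorem exists_twist_value_of_shaAn_eq
    (hGZK : rank_eq_analyticRank_of_analyticRank_le_one) (hmod : hasEntireLFunction_rat)
    (Wd : WeierstrassCurve ℚ) [Wd.IsElliptic] [Wd.IsGloballyMinimal] (p : ℕ) [Fact p.Prime]
    (hL : Wd.entireLFunction 1 ≠ 0) {q' : ℚ} (hq' : shaAn Wd = (q' : ℂ)) :
    q' ≠ 0 ∧ Wd.entireLFunction 1 / (Wd.realPeriodRat : ℂ) =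
        ((q' * (Wd.tamagawaProduct : ℚ) / (Wd.torsionOrder : ℚ) ^ 2 : ℚ) : ℂ) ∧
      padicValRat p (q' * (Wd.tamagawaProduct : ℚ) / (Wd.torsionOrder : ℚ) ^ 2) =
        padicValRat p q' + padicValNat p Wd.tamagawaProduct - 2 * padicValNat p Wd.torsionOrder := by
  have hsha := shaAn_eq_of_rankZero hGZK hmod Wd hL
  have hΩpos : 0 < Wd.realPeriodRat := Wd.realPeriodRat_pos_holds
  have hΩ : (Wd.realPeriodRat : ℂ) ≠ 0 := by exact_mod_cast hΩpos.ne'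
  have hc0 : 0 < Wd.tamagawaProduct := Wd.tamagawaProduct_pos_holds
  have ht0 : 0 < Wd.torsionOrder := Wd.torsionOrder_pos_holds
  have hcq : (Wd.tamagawaProduct : ℚ) ≠ 0 := by exact_mod_cast hc0.ne'
  have htq : (Wd.torsionOrder : ℚ) ≠ 0 := by exact_mod_cast ht0.ne'
  have htC : (Wd.torsionOrder : ℂ) ≠ 0 := by exact_mod_cast ht0.ne'
  have hcC : (Wd.tamagawaProduct : ℂ) ≠ 0 := by exact_mod_cast hc0.ne'
  have hq'0 : q' ≠ 0 := by
    intro h0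
    rw [h0, Rat.cast_zero] at hq'
    rw [hq'] at hsha
    have : Wd.entireLFunction 1 * (Wd.torsionOrder : ℂ) ^ 2 = 0 := by
      have h := hsha.symm
      rw [div_eq_zero_iff] at h
      rcases h with h | h
      · exact h
      · exact absurd h (mul_ne_zero hΩ hcC)
    rcases mul_eq_zero.mp this with h | h
    · exact hL h
    · exact htC (pow_eq_zero_iff two_ne_zero |>.mp h)
  refine ⟨hq'0, ?_, ?_⟩
  · have key : (q' : ℂ) = Wd.entireLFunction 1 * (Wd.torsionOrder : ℂ) ^ 2 /
        ((Wd.realPeriodRat : ℂ) * (Wd.tamagawaProduct : ℂ)) := by rw [← hq', hsha]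
    push_cast
    rw [key]
    field_simp
  · rw [padicValRat.div (mul_ne_zero hq'0 hcq) (pow_ne_zero 2 htq), padicValRat.mul hq'0 hcq, pow_two,
      padicValRat.mul htq htq, padicValRat.of_nat, padicValRat.of_nat]
    ring

/-- **UPPER half of the twist in Miller's currency ⟹ the `≤`-half in Jetchev–Skinner–Wan's shape**:
`Typed.MissingUpperBoundAt Wd p` (`ord_p #Ш(Wd) ≤ ord_p #Ш(Wd)_an`) gives
`∃ q, L(Wd,1)/Ω = q ∧ ord_p #Ш(Wd) + ord_p ∏c_ℓ(Wd) − 2·ord_p #Wd(ℚ)_tors ≤ ord_p q` — the binder `htw` of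
Part 8's `missingLowerBoundAt_of_adjustedIndexBound` (there supplied by Kato 2004 Thm 14.5 (3) on the
tower-surjective rows). Companion of Part 6's `twist_ge_half_of_missingLowerBoundAt`.
[cite: Miller2011LMS, §1 and Def. 1.1] [cite: JetchevSkinnerWan2017, §7.4.2 (p. 31)] -/
theorem twist_le_half_of_missingUpperBoundAt
    (hGZK : rank_eq_analyticRank_of_analyticRank_le_one) (hmod : hasEntireLFunction_rat)
    (Wd : WeierstrassCurve ℚ) [Wd.IsElliptic] [Wd.IsGloballyMinimal] (p : ℕ) [Fact p.Prime]
    (hL : Wd.entireLFunction 1 ≠ 0) (hup : Typed.MissingUpperBoundAt Wd p) :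
    ∃ q : ℚ, Wd.entireLFunction 1 / (Wd.realPeriodRat : ℂ) = (q : ℂ) ∧
      (padicValNat p Wd.shaOrder : ℤ) + padicValNat p Wd.tamagawaProduct -
        2 * padicValNat p Wd.torsionOrder ≤ padicValRat p q := by
  obtain ⟨q', hq', hv'⟩ := hup
  obtain ⟨-, hval, hv⟩ := exists_twist_value_of_shaAn_eq hGZK hmod Wd p hL hq'
  exact ⟨_, hval, by rw [hv]; linarith⟩

/-- **The twist's EXACT `p`-part in Miller's currency ⟹ the exact value shape**:
`Typed.MissingPPartAt Wd p` (`ord_p #Ш(Wd)_an = ord_p #Ш(Wd)`) gives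
`∃ q, L(Wd,1)/Ω = q ∧ ord_p q = ord_p #Ш(Wd) + ord_p ∏c_ℓ(Wd) − 2·ord_p #Wd(ℚ)_tors`.
[cite: Miller2011LMS, §1 and Def. 1.1] [cite: JetchevSkinnerWan2017, §7.4.2 (p. 31)] -/
theorem twist_exact_of_missingPPartAt
    (hGZK : rank_eq_analyticRank_of_analyticRank_le_one) (hmod : hasEntireLFunction_rat)
    (Wd : WeierstrassCurve ℚ) [Wd.IsElliptic] [Wd.IsGloballyMinimal] (p : ℕ) [Fact p.Prime]
    (hL : Wd.entireLFunction 1 ≠ 0) (hpp : Typed.MissingPPartAt Wd p) :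
    ∃ q : ℚ, Wd.entireLFunction 1 / (Wd.realPeriodRat : ℂ) = (q : ℂ) ∧
      padicValRat p q = (padicValNat p Wd.shaOrder : ℤ) + padicValNat p Wd.tamagawaProduct -
        2 * padicValNat p Wd.torsionOrder := by
  obtain ⟨q', hq', hv'⟩ := hpp
  obtain ⟨-, hval, hv⟩ := exists_twist_value_of_shaAn_eq hGZK hmod Wd p hL hq'
  exact ⟨_, hval, by rw [hv, hv']⟩

/-- Transport of `L(E^{d_K},1) ≠ 0` to a model `Wd = Cd • W^{(d_K)}` of the twist (the `L`-function is
a model invariant, `entireLFunction_smul`). Bookkeeping. [folklore] -/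
theorem twistModel_entireLFunction_one_ne_zero
    (W : WeierstrassCurve ℚ) [W.IsElliptic] (K : Type) [Field K] [NumberField K]
    (hLt : (W.quadraticTwist (NumberField.discr K : ℚ)).entireLFunction 1 ≠ 0)
    (Wd : WeierstrassCurve ℚ) [Wd.IsElliptic] (Cd : VariableChange ℚ)
    (hWd : Cd • W.quadraticTwist (NumberField.discr K : ℚ) = Wd) :
    Wd.entireLFunction 1 ≠ 0 := by
  have hD0 : (NumberField.discr K : ℚ) ≠ 0 := by exact_mod_cast NumberField.discr_ne_zero K
  haveI hEt : (W.quadraticTwist (NumberField.discr K : ℚ)).IsElliptic := W.isElliptic_quadraticTwist hD0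
  have hLt' : (W.quadraticTwist (NumberField.discr K : ℚ)).entireLFunction = Wd.entireLFunction := by
    rw [← hWd, entireLFunction_smul]
  rw [← hLt']; exact hLt

/-! ### §18 Necessity: the halves of `BSD(E,p)` and of the twist's `p`-part give STEP L′ / STEP U′ / the identity -/

section Datum

variable (W : WeierstrassCurve ℚ) [W.IsElliptic] [W.IsGloballyMinimal] (p : ℕ) [Fact p.Prime]
  (N : ℕ) [NeZero N] (K : Type) [Field K] [NumberField K]
  (Dt : ModularParametrizationData W N) (H : HeegnerDatum N (NumberField.discr K)) (ι : K →+* ℂ)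
  (P : (W.baseChange K).toAffine.Point)

/-- **NO FREE LUNCH, lower halves ⟹ STEP L′.** Data: `W/ℚ` globally minimal of conductor `N` with
`ord_{s=1} L(E,s) = 1`; `K` imaginary quadratic, Heegner for `N`, `L(E^{d_K},1) ≠ 0`; `P ∈ E(K)` the Heegner
point of ANY datum `Dt`; `p` odd with `p ∤ #𝓞_K^×`; `Wd = Cd • W^{(d_K)}` globally minimal with `ord_p u(Cd) = 0`
(ANY reduction type at `p`, NO image hypothesis). PUBLISHED binders `hGZ`, `hKo`, `hGZK`, `hmod`. Then the
two LOWER halves — `Typed.MissingLowerBoundAt W p` (the crux's conclusion at the pair) and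
`Typed.MissingLowerBoundAt Wd p` (the rank-zero lower half at the twist, crux 19357's conclusion at
`(Wd, p)`) — give the road's typed input STEP L′:
`2·ord_p[E(K):ℤP] ≤ ord_p #Ш(E/K) + ord_p ∏c_ℓ(E) + ord_p ∏c_ℓ(Wd) + 2·ord_p c(Dt)`.
Arithmetic on Part 4's identity: `2v(I) = v(q) + v(q_d) + v(c_E) + 2v(t_d) + 2v(c)` with `v(q) ≤ v(Ш_E)` and
`v(q_d) ≤ v(Ш_d) + v(c_d) − 2v(t_d)`, and `v(Ш_K) = v(Ш_E) + v(Ш_d)`.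
[cite: JetchevSkinnerWan2017, §7.4.1 (pp. 29–31)] [cite: GrossZagier1986, V.§2 and Conj. (V.2.2)]
[cite: Miller2011LMS, Def. 1.1] -/
theorem adjustedIndexBound_of_missingLowerBoundAt_of_twistLower
    (hGZ : gross_zagier N W K) (hKo : kolyvagin N W K)
    (hGZK : rank_eq_analyticRank_of_analyticRank_le_one) (hmod : hasEntireLFunction_rat)
    (hK : IsImaginaryQuadratic K) (hHN : SatisfiesHeegnerHypothesis N K)
    (hP : WeierstrassCurve.Affine.Point.map ι.toRatAlgHom P = heegnerPointComplex Dt H)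
    (hp2 : p ≠ 2) (hμ : ¬ p ∣ Units.torsionOrder K)
    (hr : W.analyticRank = 1)
    (hLt : (W.quadraticTwist (NumberField.discr K : ℚ)).entireLFunction 1 ≠ 0)
    (Wd : WeierstrassCurve ℚ) [Wd.IsElliptic] [Wd.IsGloballyMinimal] (Cd : VariableChange ℚ)
    (hWd : Cd • W.quadraticTwist (NumberField.discr K : ℚ) = Wd)
    (hu : padicValRat p (Cd.u : ℚ) = 0)
    (hlow : Typed.MissingLowerBoundAt W p) (htwL : Typed.MissingLowerBoundAt Wd p) :
    (2 * padicValNat p (AddSubgroup.zmultiples P).index : ℤ) ≤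
      padicValNat p (W.baseChange K).shaOrder + padicValNat p W.tamagawaProduct +
        padicValNat p Wd.tamagawaProduct + 2 * padicValRat p (Dt.c : ℚ) := by
  have hLd1 : Wd.entireLFunction 1 ≠ 0 := twistModel_entireLFunction_one_ne_zero W K hLt Wd Cd hWd
  obtain ⟨qd, hqd, hvqd⟩ := twist_ge_half_of_missingLowerBoundAt hGZK hmod Wd p hLd1 htwL
  obtain ⟨-, -, hsha, q, hq, hval⟩ := exists_shaAn_padicVal_eq_of_heegner_maninKept W p N K Dt H ι P
    hGZ hKo hGZK hmod hK hHN hP hp2 hμ hr hLt Wd Cd hWd hu qd hqd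
  obtain ⟨q₁, hq₁, hv₁⟩ := hlow
  have hqq : q₁ = q := by exact_mod_cast hq₁.symm.trans hq
  subst hqq
  have e2 : (padicValNat p (W.baseChange K).shaOrder : ℤ) =
      padicValNat p W.shaOrder + padicValNat p Wd.shaOrder := by exact_mod_cast hsha
  linarith

/-- **NO FREE LUNCH, upper halves ⟹ STEP U′ (the reverse inequality).** Same data and PUBLISHED binders;
the two UPPER halves `Typed.MissingUpperBoundAt W p` and `Typed.MissingUpperBoundAt Wd p` give
`ord_p #Ш(E/K) + ord_p ∏c_ℓ(E) + ord_p ∏c_ℓ(Wd) + 2·ord_p c(Dt) ≤ 2·ord_p[E(K):ℤP]`.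
[cite: JetchevSkinnerWan2017, §7.4.2 (p. 31)] [cite: GrossZagier1986, V.§2 and Conj. (V.2.2)]
[cite: Miller2011LMS, Def. 1.1] -/
theorem adjustedIndexUpperBound_of_missingUpperBoundAt_of_twistUpper
    (hGZ : gross_zagier N W K) (hKo : kolyvagin N W K)
    (hGZK : rank_eq_analyticRank_of_analyticRank_le_one) (hmod : hasEntireLFunction_rat)
    (hK : IsImaginaryQuadratic K) (hHN : SatisfiesHeegnerHypothesis N K)
    (hP : WeierstrassCurve.Affine.Point.map ι.toRatAlgHom P = heegnerPointComplex Dt H)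
    (hp2 : p ≠ 2) (hμ : ¬ p ∣ Units.torsionOrder K)
    (hr : W.analyticRank = 1)
    (hLt : (W.quadraticTwist (NumberField.discr K : ℚ)).entireLFunction 1 ≠ 0)
    (Wd : WeierstrassCurve ℚ) [Wd.IsElliptic] [Wd.IsGloballyMinimal] (Cd : VariableChange ℚ)
    (hWd : Cd • W.quadraticTwist (NumberField.discr K : ℚ) = Wd)
    (hu : padicValRat p (Cd.u : ℚ) = 0)
    (hup : Typed.MissingUpperBoundAt W p) (htwU : Typed.MissingUpperBoundAt Wd p) :
    (padicValNat p (W.baseChange K).shaOrder : ℤ) + padicValNat p W.tamagawaProduct +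
        padicValNat p Wd.tamagawaProduct + 2 * padicValRat p (Dt.c : ℚ) ≤
      2 * padicValNat p (AddSubgroup.zmultiples P).index := by
  have hLd1 : Wd.entireLFunction 1 ≠ 0 := twistModel_entireLFunction_one_ne_zero W K hLt Wd Cd hWd
  obtain ⟨qd, hqd, hvqd⟩ := twist_le_half_of_missingUpperBoundAt hGZK hmod Wd p hLd1 htwU
  obtain ⟨-, -, hsha, q, hq, hval⟩ := exists_shaAn_padicVal_eq_of_heegner_maninKept W p N K Dt H ι P
    hGZ hKo hGZK hmod hK hHN hP hp2 hμ hr hLt Wd Cd hWd hu qd hqd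
  obtain ⟨q₁, hq₁, hv₁⟩ := hup
  have hqq : q₁ = q := by exact_mod_cast hq₁.symm.trans hq
  subst hqq
  have e2 : (padicValNat p (W.baseChange K).shaOrder : ℤ) =
      padicValNat p W.shaOrder + padicValNat p Wd.shaOrder := by exact_mod_cast hsha
  linarith

/-- **NO FREE LUNCH, both `p`-parts ⟹ the adjusted index IDENTITY** (the `p`-part of Gross–Zagier's
Conjecture V.(2.2) / Gross 1991 (2.2) at an ARBITRARY parametrisation datum, Manin term kept, at any odd
`p ∤ #𝓞_K^×`): `Typed.MissingPPartAt W p ∧ Typed.MissingPPartAt Wd p` give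
`2·ord_p[E(K):ℤP] = ord_p #Ш(E/K) + ord_p ∏c_ℓ(E) + ord_p ∏c_ℓ(Wd) + 2·ord_p c(Dt)`.
[cite: GrossZagier1986, V.§2 and Conj. (V.2.2)] [cite: Gross1991, (2.2)] [cite: Miller2011LMS, Def. 1.1] -/
theorem adjustedIndexIdentity_of_missingPPartAt_of_twist
    (hGZ : gross_zagier N W K) (hKo : kolyvagin N W K)
    (hGZK : rank_eq_analyticRank_of_analyticRank_le_one) (hmod : hasEntireLFunction_rat)
    (hK : IsImaginaryQuadratic K) (hHN : SatisfiesHeegnerHypothesis N K)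
    (hP : WeierstrassCurve.Affine.Point.map ι.toRatAlgHom P = heegnerPointComplex Dt H)
    (hp2 : p ≠ 2) (hμ : ¬ p ∣ Units.torsionOrder K)
    (hr : W.analyticRank = 1)
    (hLt : (W.quadraticTwist (NumberField.discr K : ℚ)).entireLFunction 1 ≠ 0)
    (Wd : WeierstrassCurve ℚ) [Wd.IsElliptic] [Wd.IsGloballyMinimal] (Cd : VariableChange ℚ)
    (hWd : Cd • W.quadraticTwist (NumberField.discr K : ℚ) = Wd)
    (hu : padicValRat p (Cd.u : ℚ) = 0)
    (hpp : Typed.MissingPPartAt W p) (htw : Typed.MissingPPartAt Wd p) :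
    (2 * padicValNat p (AddSubgroup.zmultiples P).index : ℤ) =
      padicValNat p (W.baseChange K).shaOrder + padicValNat p W.tamagawaProduct +
        padicValNat p Wd.tamagawaProduct + 2 * padicValRat p (Dt.c : ℚ) := by
  obtain ⟨hl, hu'⟩ := lower_and_upper_of_missingPPartAt W p hpp
  obtain ⟨hld, hud⟩ := lower_and_upper_of_missingPPartAt Wd p htw
  exact le_antisymm
    (adjustedIndexBound_of_missingLowerBoundAt_of_twistLower W p N K Dt H ι P hGZ hKo hGZK hmod hK hHN hP
      hp2 hμ hr hLt Wd Cd hWd hu hl hld)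
    (adjustedIndexUpperBound_of_missingUpperBoundAt_of_twistUpper W p N K Dt H ι P hGZ hKo hGZK hmod hK
      hHN hP hp2 hμ hr hLt Wd Cd hWd hu hu' hud)

/-- **The adjusted index identity from Miller's `BSD(E,p) ∧ BSD(E^{d_K},p)`** (finiteness of `Ш(E)` and
`Ш(Wd)` holds at the datum by Gross–Zagier–Kolyvagin, so `BSDp` gives the exact `p`-parts,
`Typed.missingPPartAt_of_bsdp`). STEP L′ is therefore a CONSEQUENCE of BSD at every datum: as a
`∀`-statement over the cell it cannot be refuted short of refuting BSD.
[cite: GrossZagier1986, V.§2 and Conj. (V.2.2)] [cite: Miller2011LMS, §1 and Def. 1.1] -/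
theorem adjustedIndexIdentity_of_bsdp_of_bsdp
    (hGZ : gross_zagier N W K) (hKo : kolyvagin N W K)
    (hGZK : rank_eq_analyticRank_of_analyticRank_le_one) (hmod : hasEntireLFunction_rat)
    (hK : IsImaginaryQuadratic K) (hHN : SatisfiesHeegnerHypothesis N K)
    (hP : WeierstrassCurve.Affine.Point.map ι.toRatAlgHom P = heegnerPointComplex Dt H)
    (hp2 : p ≠ 2) (hμ : ¬ p ∣ Units.torsionOrder K)
    (hr : W.analyticRank = 1)
    (hLt : (W.quadraticTwist (NumberField.discr K : ℚ)).entireLFunction 1 ≠ 0)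
    (Wd : WeierstrassCurve ℚ) [Wd.IsElliptic] [Wd.IsGloballyMinimal] (Cd : VariableChange ℚ)
    (hWd : Cd • W.quadraticTwist (NumberField.discr K : ℚ) = Wd)
    (hu : padicValRat p (Cd.u : ℚ) = 0)
    (hB : BSDp W p) (hBd : BSDp Wd p) :
    (2 * padicValNat p (AddSubgroup.zmultiples P).index : ℤ) =
      padicValNat p (W.baseChange K).shaOrder + padicValNat p W.tamagawaProduct +
        padicValNat p Wd.tamagawaProduct + 2 * padicValRat p (Dt.c : ℚ) := by
  have hLd1 : Wd.entireLFunction 1 ≠ 0 := twistModel_entireLFunction_one_ne_zero W K hLt Wd Cd hWd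
  have hrd : Wd.analyticRank = 0 := (Wd.analyticRank_eq_zero_iff_holds (hmod Wd)).2 hLd1
  haveI : Finite Wd.sha := (hGZK Wd (by rw [hrd]; exact zero_le_one)).2
  haveI : Finite W.sha := (hGZK W (le_of_eq hr)).2
  exact adjustedIndexIdentity_of_missingPPartAt_of_twist W p N K Dt H ι P hGZ hKo hGZK hmod hK hHN hP hp2 hμ
    hr hLt Wd Cd hWd hu (missingPPartAt_of_bsdp W p hB) (missingPPartAt_of_bsdp Wd p hBd)

end Datum

/-! ### §20 The `∀`-form: the crux BY NAME returns STEP L′ at every datum of every rank-one row of the cell -/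

/-- **The crux implies its own typed input (no free lunch, `∀`-form).** `GordTwoRankOne` (item 19358, as a
HYPOTHESIS) together with the rank-zero LOWER half at the twist (`htwL : Typed.MissingLowerBoundAt Wd p`,
crux 19357's conclusion at `(Wd, p)`) gives STEP L′ at EVERY Heegner datum of every rank-one row `(W, p)` of
cell (G-ord, `e = 2`) (any image; `K` any Heegner field of `N = N_E` with `p ∤ #𝓞_K^×` and
`L(E^{d_K},1) ≠ 0`; `Wd` any globally minimal model of the twist — at an additive `p` its unit is
automatically prime to `p`, Part 1's `padicValRat_u_eq_zero_of_twist_minimal'`). PUBLISHED binders `hGZ`,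
`hKo`, `hGZK`, `hmod`. The converse (STEP L′ ⟹ the crux on the tower-surjective rows, PUBLISHED facts only)
is Part 8's `cellGordTwo_missingLowerBoundAt_rankOne_of_towerSurj_of_adjustedIndexBound`.
[cite: JetchevSkinnerWan2017, §7.4.1 (pp. 29–31)] [cite: Miller2011LMS, Def. 1.1] -/
theorem adjustedIndexBound_of_gordTwoRankOne_of_twistLower
    (hcrux : Summit.BirchSwinnertonDyer.BirchSwinnertonDyer.Theses.AdditiveBranchIMC.GordTwoRankOne)
    (W : WeierstrassCurve ℚ) [W.IsElliptic] [W.IsGloballyMinimal] (p : ℕ) [Fact p.Prime]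
    (N : ℕ) [NeZero N] (K : Type) [Field K] [NumberField K]
    (Dt : ModularParametrizationData W N) (H : HeegnerDatum N (NumberField.discr K)) (ι : K →+* ℂ)
    (P : (W.baseChange K).toAffine.Point)
    (hGZ : gross_zagier N W K) (hKo : kolyvagin N W K)
    (hGZK : rank_eq_analyticRank_of_analyticRank_le_one) (hmod : hasEntireLFunction_rat)
    (hr : W.analyticRank = 1) (hcell : N10.CellGordTwo W p) (hN : W.conductorNorm ℤ = N)
    (hK : IsImaginaryQuadratic K) (hHN : SatisfiesHeegnerHypothesis N K)
    (hP : WeierstrassCurve.Affine.Point.map ι.toRatAlgHom P = heegnerPointComplex Dt H)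
    (hμ : ¬ p ∣ Units.torsionOrder K)
    (hLt : (W.quadraticTwist (NumberField.discr K : ℚ)).entireLFunction 1 ≠ 0)
    (Wd : WeierstrassCurve ℚ) [Wd.IsElliptic] [Wd.IsGloballyMinimal] (Cd : VariableChange ℚ)
    (hWd : Cd • W.quadraticTwist (NumberField.discr K : ℚ) = Wd)
    (htwL : Typed.MissingLowerBoundAt Wd p) :
    (2 * padicValNat p (AddSubgroup.zmultiples P).index : ℤ) ≤
      padicValNat p (W.baseChange K).shaOrder + padicValNat p W.tamagawaProduct +
        padicValNat p Wd.tamagawaProduct + 2 * padicValRat p (Dt.c : ℚ) := by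
  have hlow : Typed.MissingLowerBoundAt W p := hcrux W p hr hcell
  obtain ⟨hp2, hadd, -, -⟩ := hcell
  subst hN
  have hu : padicValRat p (Cd.u : ℚ) = 0 :=
    padicValRat_u_eq_zero_of_twist_minimal' W p K hK hHN hadd.1 Cd hWd
  exact adjustedIndexBound_of_missingLowerBoundAt_of_twistLower W p (W.conductorNorm ℤ) K Dt H ι P hGZ hKo
    hGZK hmod hK hHN hP hp2 hμ hr hLt Wd Cd hWd hu hlow htwL

end Summit.BirchSwinnertonDyer.BirchSwinnertonDyer.Theorems.AdditiveBranchIMCGordTwoRankOne.HeegnerKolyvagin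

end
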